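import Mathlib
import Literature.NumberTheory.LFunctions.Zhang2022.TypedAppendixB
import Literature.NumberTheory.LFunctions.Zhang2022.AppendixBTailB3U013
import HarnessLib

/-!
# Zhang (2022), Appendix B, proof of (B.3): the step `Z22:§B.u015` (first line) in the reading of
# record — the smoothed series IS the double integral (Fubini), kernel-checked

Topic `Literature/NumberTheory/LFunctions/Zhang2022` (Landau–Siegel audit tree; verdict-neutral).
Y. Zhang, *Discrete mean estimates and the Landau–Siegel zero*, arXiv:2211.02515v1 (2022)
[Zhang2022LandauSiegel] — **an unrefereed manuscript under adjudication; nothing here asserts or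
denies its Theorems 1–2.** Appendix B p. 108 (tex L5326–L5331, DAG `Z22:§B.u014`/`Z22:§B.u015`, first
line): after "By a change of variable … `(P₁/y)^{β₆}{g(P^z/y) − g(P^{0.5}/y)} = (1/2πi)∫_{(1)} …`"
(`Typed.AppendixB.StepB_u014`, a theorem of the tree) the source continues "Hence, in a way similar to
the proof of, we find that the left side of (B.3) is equal to
`(1/0.504)∫_{0.5}^{0.504} {(1/2πi)∫_{(1)} (P^{β₆(0.504−z)}P^{zs} − P^{0.004β₆}P^{0.5s}) ζ(1+s)/ζ(1+s−β_j)
ω₁(s−β₆) ds/(l₁ˢ(s−β₆))} dz + O`" — typed `Typed.AppendixB.StepB_u015aR c′`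
(`‖tailB3 − doubleB15‖ ≤ C·α₁`, `α₁ = α log T`, the cell's reading of record of the bare "`+O`").

PROOF (`stepB_u015aR_holds`). The smoothed series of the preceding display,
`seriesB13 = Σ_l ϱ_j(l)/l (P₁/(l₁l))^{β₆} (1/0.504)∫_{0.5}^{0.504}{g(P^z/(l₁l)) − g(P^{0.5}/(l₁l))}dz`,
EQUALS `doubleB15` exactly (`seriesB13_eq_doubleB15`, every modulus `D ≥ 3`, every `l₁ ≥ 1`):
(i) for each `z`, the inner line integral is `Σ_l ϱ_j(l)/l (P₁/(l₁l))^{β₆}{g(P^z/(l₁l)) − g(P^{0.5}/(l₁l))}`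
(`vline_inner_eq`) — on `Re s = 1`, `ζ(1+s)/ζ(1+s−β_j) = Σ_l ϱ_j(l)l^{−1−s}` (`stepB_u007_holds`), the
kernel is `β₆`-translated to the §4 Mellin kernel `X^wω₁(w)/w`, and the interchange of `Σ_l` and `∫_t`
is the tree's `GaussWeight.integral_LSeries_mul_kernel` (absolute convergence at `Re = 2`);
(ii) the interchange of `∫_z` over `[0.5, 0.504]` and `Σ_l` is dominated: `0 < g(x) ≤ x`
(`gWeight_le_self`, `Λ = 𝓛³⁰ ≥ 2`), so the `l`-th term is `≤ 2P^{0.504}τ(l)/(l₁l²)` uniformly in `z`.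
Combined with `Z22:§B.u013` in the reading of record (`AppendixBVarrho.stepB_u013R_holds`,
`‖tailB3 − seriesB13‖ ≤ C·α₁`) this gives `StepB_u015aR` with the same constant. No claim about
Lemma 15.1, Theorems 1–2 of the source or about Landau–Siegel zeros is made.

## References

* Y. Zhang, arXiv:2211.02515v1 (2022), App. B p. 108 (proof of (B.3)); §4 (4.1)–(4.3).
  [cite: Zhang2022LandauSiegel, App. B p.108]
-/

noncomputable section

open Complex Real MeasureTheory Set Filter

namespace Literature.NumberTheory.LFunctions.Zhang2022.AppendixBVarrho

open Literature.NumberTheory.LFunctions.Zhang2022 Skeleton Typed.AppendixB GaussWeight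

/-! ## Small facts -/

/-- `Σ_l ϱ_j(l) l^{−s}` converges absolutely for `Re s > 3/2` (`|ϱ_j(l)| ≤ τ₂(l) ≤ C l^{1/2}`).
[cite: Zhang2022LandauSiegel, App. B p.107] -/
theorem LSeriesSummable_varrhoJ (c' : ℝ) (D j : ℕ) {s : ℂ} (hs : 3 / 2 < s.re) :
    LSeriesSummable (fun n => varrhoJ c' D j n) s := by
  obtain ⟨C, -, hC⟩ :=
    Literature.NumberTheory.Sieve.exists_card_divisors_le_mul_rpow' (ε := (1 / 2 : ℝ)) (by norm_num)
  refine LSeriesSummable_of_le_const_mul_rpow (x := 3 / 2) hs ⟨C, fun n _ => ?_⟩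
  calc ‖varrhoJ c' D j n‖ ≤ (n.divisors.card : ℝ) := norm_varrhoJ_le c' D j n
    _ ≤ C * (n : ℝ) ^ (1 / 2 : ℝ) := hC n
    _ = C * (n : ℝ) ^ ((3 / 2 : ℝ) - 1) := by norm_num

/-- **`g(x) ≤ x` for every `x > 0`** once `Λ ≥ 2`: for `x ≥ 1` because `g < 1`; for `1/2 ≤ x < 1`
because `g(x) ≤ ½`; for `x < 1/2` from (4.3), `g(x) ≤ ½e^{−Λlog²x} ≤ ½e^{log x}` since
`Λ·log²x ≥ 2(log 2)|log x| ≥ |log x|`. [cite: Zhang2022LandauSiegel, §4 (4.3)] -/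
theorem gWeight_le_self {Λ x : ℝ} (hΛ : 2 ≤ Λ) (hx : 0 < x) : gWeight Λ x ≤ x := by
  have hΛ0 : 0 < Λ := by linarith
  rcases le_or_gt 1 x with h1 | h1
  · exact (gWeight_lt_one hΛ0 x).le.trans h1
  have hg := gWeight_le hΛ0 hx h1.le
  rcases le_or_gt (1 / 2) x with h2 | h2
  · refine hg.trans ?_
    have hexp : rexp (-Λ * (Real.log x) ^ 2) ≤ 1 := by
      rw [Real.exp_le_one_iff]
      nlinarith [sq_nonneg (Real.log x)]
    nlinarith
  · refine hg.trans ?_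
    have hlogx : Real.log x < -Real.log 2 := by
      rw [← Real.log_inv]
      exact Real.log_lt_log hx (by rw [← one_div]; exact h2)
    have hlog2 : (0.6931471803 : ℝ) < Real.log 2 := Real.log_two_gt_d9
    have hneg : Real.log x < 0 := by linarith
    have hkey : -Λ * (Real.log x) ^ 2 ≤ Real.log x := by
      -- `Λ log²x ≥ 2·(log 2)·|log x| ≥ |log x|`
      have h3 : (1 : ℝ) ≤ Λ * (-Real.log x) := by nlinarith
      nlinarith
    calc (1 / 2) * rexp (-Λ * (Real.log x) ^ 2) ≤ (1 / 2) * rexp (Real.log x) := by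
          gcongr
      _ = (1 / 2) * x := by rw [Real.exp_log hx]
      _ ≤ x := by linarith

/-- `𝓛³⁰ ≥ 2` for `D ≥ 3` (`𝓛 = log D > 1.09`). [cite: Zhang2022LandauSiegel, §2 (2.1)] -/
private theorem two_le_ell_pow_thirty {D : ℕ} (hD : 3 ≤ D) : 2 ≤ ell D ^ 30 := by
  have hℓ : 1 < ell D := one_lt_ell hD
  -- `𝓛 ≥ log 3 > 1.098`, and `1.098³⁰ > 2`; cruder: `𝓛³⁰ ≥ 𝓛² ≥ …` is not enough, use `log 3`.
  have h3 : (3 : ℝ) ≤ D := by exact_mod_cast hD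
  have hlog3 : (1.0986122885 : ℝ) < Real.log 3 := Real.log_three_gt_d9
  have hℓ3 : 1.0986122885 ≤ ell D :=
    hlog3.le.trans (Real.log_le_log (by norm_num) h3)
  have h8 : (1.0986122885 : ℝ) ^ 30 ≤ ell D ^ 30 := pow_le_pow_left₀ (by norm_num) hℓ3 30
  have hnum : (2 : ℝ) ≤ (1.0986122885 : ℝ) ^ 30 := by norm_num
  linarith

/-! ## The line `Re s = 1`: the `L`-series against the Mellin kernel is integrable -/

/-- The product `L(a, s+c+it)·K_X(t)` of an absolutely convergent `L`-series (at `Re = σ + c`) and the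
§4 kernel `K_X(t) = X^{c+it}ω₁(c+it)/(c+it)` is integrable over the line: `|L| ≤ Σ|aₙ|n^{−σ−c}` and the
kernel is Gaussian-dominated (`GaussWeight.integrable_kernel`). [cite: Zhang2022LandauSiegel, §4 (4.1)] -/
theorem integrable_LSeries_mul_kernel {Λ c X : ℝ} (hΛ : 0 < Λ) (hc : 0 < c) (hX : 0 < X)
    {a : ℕ → ℂ} {s : ℂ} (hs : LSeriesSummable a (s + c)) :
    Integrable (fun t : ℝ => LSeries a (s + (c + t * I)) * kernel Λ c X t) := by
  -- termwise norms on the line equal those at `s + c`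
  have hnorm : ∀ (t : ℝ) (n : ℕ), ‖LSeries.term a (s + (c + t * I)) n‖ = ‖LSeries.term a (s + c) n‖ := by
    intro t n
    rw [LSeries.norm_term_eq, LSeries.norm_term_eq]
    simp
  have hsum : Summable fun n : ℕ => ‖LSeries.term a (s + c) n‖ := summable_norm_iff.mpr hs
  -- continuity of `t ↦ L(a, s + c + it)` (uniformly convergent series of continuous terms)
  have hcont : Continuous fun t : ℝ => LSeries a (s + (c + t * I)) := by
    refine continuous_tsum (fun n => ?_) hsum (fun n t => (hnorm t n).le)
    rcases eq_or_ne n 0 with rfl | hn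
    · simp only [LSeries.term_zero]; exact continuous_const
    · have h : Continuous fun t : ℝ => (n : ℂ) ^ (s + (c + t * I)) :=
        Continuous.const_cpow (by fun_prop) (Or.inl (by exact_mod_cast hn))
      simp_rw [LSeries.term_of_ne_zero hn]
      exact continuous_const.div h fun t => by
        rw [Ne, Complex.cpow_eq_zero_iff]; exact fun h' => (by exact_mod_cast hn : (n : ℂ) ≠ 0) h'.1
  -- the uniform bound
  have hbdd : ∀ t : ℝ, ‖LSeries a (s + (c + t * I))‖ ≤ ∑' n : ℕ, ‖LSeries.term a (s + c) n‖ := by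
    intro t
    have h1 : Summable fun n : ℕ => ‖LSeries.term a (s + (c + t * I)) n‖ :=
      hsum.congr fun n => (hnorm t n).symm
    calc ‖LSeries a (s + (c + t * I))‖ ≤ ∑' n : ℕ, ‖LSeries.term a (s + (c + t * I)) n‖ :=
          norm_tsum_le_tsum_norm h1
      _ = ∑' n : ℕ, ‖LSeries.term a (s + c) n‖ := tsum_congr (hnorm t)
  exact (GaussWeight.integrable_kernel hΛ hc hX).bdd_mul hcont.aestronglyMeasurable (ae_of_all _ hbdd)

/-! ## The pointwise change of variable `w = s − β₆` (as in `Typed.AppendixB.stepB_u014_holds`) -/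

/-- `P^{(a·β)} = (P^a)^β` for a real `a` and `P > 0` (copy of the private lemma of `TypedAppendixB`).
[folklore] -/
private theorem cpow_ofReal_mul' {P : ℝ} (hP : 0 < P) (a : ℝ) (β : ℂ) :
    (P : ℂ) ^ ((a : ℂ) * β) = ((P ^ a : ℝ) : ℂ) ^ β := by
  rw [Complex.ofReal_cpow hP.le, Complex.cpow_mul]
  · rw [← Complex.ofReal_log hP.le, ← Complex.ofReal_mul, Complex.ofReal_im]
    exact neg_lt_zero.mpr Real.pi_pos
  · rw [← Complex.ofReal_log hP.le, ← Complex.ofReal_mul, Complex.ofReal_im]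
    exact Real.pi_pos.le

/-- On `s = β + w`: `P^{βc₀} P^{c_z s} ω₁(s−β)/(yˢ(s−β)) = (P^{0.504}/y)^β · (P^{c_z}/y)ʷ ω₁(w)/w` when
`c₀ + c_z = 0.504` (copy of the private lemma of `TypedAppendixB`). [cite: Zhang2022LandauSiegel, App. B p.108] -/
private theorem mellin_term_eq' {P y Λ c₀ cz : ℝ} (hP : 0 < P) (hy : 0 < y) (hc : c₀ + cz = 0.504)
    (β w : ℂ) :
    (P : ℂ) ^ (β * (c₀ : ℂ)) * (P : ℂ) ^ ((cz : ℂ) * (β + w)) *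
        GaussWeight.omega1 Λ ((β + w) - β) / ((y : ℂ) ^ (β + w) * ((β + w) - β)) =
      ((P ^ (0.504 : ℝ) / y : ℝ) : ℂ) ^ β *
        (((P ^ cz / y : ℝ) : ℂ) ^ w * GaussWeight.omega1 Λ w / w) := by
  have hP' : (P : ℂ) ≠ 0 := by exact_mod_cast hP.ne'
  have hy' : (y : ℂ) ≠ 0 := by exact_mod_cast hy.ne'
  have hPc : 0 < P ^ cz := Real.rpow_pos_of_pos hP cz
  have hP5 : 0 < P ^ (0.504 : ℝ) := Real.rpow_pos_of_pos hP _
  rw [add_sub_cancel_left, GaussWeight.div_cpow_line hP5 hy, GaussWeight.div_cpow_line hPc hy,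
    Complex.cpow_add _ _ hy', mul_add, Complex.cpow_add _ _ hP']
  have hexp : (P : ℂ) ^ (β * (c₀ : ℂ)) * (P : ℂ) ^ ((cz : ℂ) * β) =
      ((P ^ (0.504 : ℝ) : ℝ) : ℂ) ^ β := by
    rw [← Complex.cpow_add _ _ hP', ← cpow_ofReal_mul' hP]
    congr 1
    rw [← hc]
    push_cast
    ring
  have hz : (P : ℂ) ^ ((cz : ℂ) * w) = ((P ^ cz : ℝ) : ℂ) ^ w := cpow_ofReal_mul' hP cz w
  rw [hz]
  have hyβ : (y : ℂ) ^ β ≠ 0 := by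
    rw [Ne, Complex.cpow_eq_zero_iff]; exact fun h => hy' h.1
  have hyw : (y : ℂ) ^ w ≠ 0 := by
    rw [Ne, Complex.cpow_eq_zero_iff]; exact fun h => hy' h.1
  calc (P : ℂ) ^ (β * (c₀ : ℂ)) * ((P : ℂ) ^ ((cz : ℂ) * β) * ((P ^ cz : ℝ) : ℂ) ^ w) *
        GaussWeight.omega1 Λ w / ((y : ℂ) ^ β * (y : ℂ) ^ w * w)
      = ((P : ℂ) ^ (β * (c₀ : ℂ)) * (P : ℂ) ^ ((cz : ℂ) * β)) *
          (((P ^ cz : ℝ) : ℂ) ^ w * GaussWeight.omega1 Λ w / ((y : ℂ) ^ β * (y : ℂ) ^ w * w)) := by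
        ring
    _ = _ := by rw [hexp]; field_simp

/-! ## (i) The inner line integral, summed -/

/-- **The inner line integral of `doubleB15` is the `l`-series termwise**: for `D ≥ 3`, `j ∈ {1,2,3}`,
`l₁ ≥ 1` and every real `z`,
`(1/2πi)∫_{(1)} (P^{β₆(0.504−z)}P^{zs} − P^{0.004β₆}P^{0.5s}) ζ(1+s)/ζ(1+s−β_j) ω₁(s−β₆) ds/(l₁ˢ(s−β₆))
= Σ_l ϱ_j(l)/l · (P₁/(l₁l))^{β₆} · (g(P^z/(l₁l)) − g(P^{0.5}/(l₁l)))`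
(`ζ(1+s)/ζ(1+s−β_j) = Σ ϱ_j(l)l^{−1−s}` on the line, `stepB_u007_holds`; translation `w = s − β₆`;
`GaussWeight.integral_LSeries_mul_kernel`). [cite: Zhang2022LandauSiegel, App. B p.108] -/
theorem vline_inner_eq (c' : ℝ) {D : ℕ} (hD : 3 ≤ D) {j : ℕ} (hj : j ∈ ({1, 2, 3} : Finset ℕ))
    {l₁ : ℕ} (hl₁ : 1 ≤ l₁) (z : ℝ) :
    vline 1 (fun s => mellinB14 D z s * zetaRatio c' D j s *
        GaussWeight.omega1 (Skeleton.ell D ^ 30) (s - Skeleton.beta6 D) /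
          ((l₁ : ℂ) ^ s * (s - Skeleton.beta6 D))) =
      ∑' l : ℕ, varrhoJ c' D j l / (l : ℂ) *
        ((Skeleton.P1 D / (l₁ * l : ℕ) : ℝ) : ℂ) ^ Skeleton.beta6 D *
        ((Skeleton.gW D (Skeleton.bigP D ^ z / (l₁ * l : ℕ)) -
            Skeleton.gW D (Skeleton.bigP D ^ (0.5 : ℝ) / (l₁ * l : ℕ)) : ℝ) : ℂ) := by
  have hℓ : 0 < Skeleton.ell D := by linarith [Skeleton.one_lt_ell hD]
  have hΛ : 0 < Skeleton.ell D ^ 30 := pow_pos hℓ 30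
  have hP : 0 < Skeleton.bigP D := Real.exp_pos _
  set Λ : ℝ := Skeleton.ell D ^ 30 with hΛdef
  set P : ℝ := Skeleton.bigP D with hPdef
  set y : ℝ := (l₁ : ℝ) with hydef
  have hy : 0 < y := by rw [hydef]; exact_mod_cast hl₁
  set b : ℝ := 3 * Skeleton.alpha D / 2 with hb
  have hβ : Skeleton.beta6 D = (b : ℂ) * I := by
    rw [Skeleton.beta6, hb]; push_cast; ring
  set β : ℂ := Skeleton.beta6 D with hβdef
  set ρ : ℕ → ℂ := fun n => varrhoJ c' D j n with hρ
  -- the §4 kernels at `X = P^{cz}/y`, translated by `b`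
  set A : ℝ → ℝ → ℂ := fun cz t =>
    ((P ^ (0.504 : ℝ) / y : ℝ) : ℂ) ^ β * GaussWeight.kernel Λ 1 (P ^ cz / y) (t - b) with hA
  have hline : ∀ t : ℝ, ((1 : ℝ) : ℂ) + (t : ℂ) * I = β + (((1 : ℝ) : ℂ) + ((t - b : ℝ) : ℂ) * I) := by
    intro t; rw [hβ]; push_cast; ring
  -- the kernel part, pointwise (exactly as in `stepB_u014_holds`, with `y = l₁`)
  have hker : ∀ t : ℝ,
      mellinB14 D z (((1 : ℝ) : ℂ) + (t : ℂ) * I) *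
          GaussWeight.omega1 Λ ((((1 : ℝ) : ℂ) + (t : ℂ) * I) - β) /
        ((y : ℂ) ^ (((1 : ℝ) : ℂ) + (t : ℂ) * I) * ((((1 : ℝ) : ℂ) + (t : ℂ) * I) - β)) =
      A z t - A 0.5 t := by
    intro t
    simp only [hA, GaussWeight.kernel, mellinB14, ← hPdef, ← hβdef]
    rw [sub_mul, sub_div, hline t,
      mellin_term_eq' hP hy (by ring : (0.504 - z) + z = 0.504) β _,
      mul_comm (((0.004 : ℝ) : ℂ)) β,
      mellin_term_eq' hP hy (by norm_num : (0.004 : ℝ) + 0.5 = 0.504) β _]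
  -- the full integrand, pointwise
  have hpt : ∀ t : ℝ,
      mellinB14 D z (((1 : ℝ) : ℂ) + (t : ℂ) * I) * zetaRatio c' D j (((1 : ℝ) : ℂ) + (t : ℂ) * I) *
          GaussWeight.omega1 Λ ((((1 : ℝ) : ℂ) + (t : ℂ) * I) - β) /
        (((l₁ : ℂ)) ^ (((1 : ℝ) : ℂ) + (t : ℂ) * I) * ((((1 : ℝ) : ℂ) + (t : ℂ) * I) - β)) =
      zetaRatio c' D j (((1 : ℝ) : ℂ) + (t : ℂ) * I) * A z t -
        zetaRatio c' D j (((1 : ℝ) : ℂ) + (t : ℂ) * I) * A 0.5 t := by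
    intro t
    have hyC : ((l₁ : ℂ)) = (y : ℂ) := by rw [hydef]; push_cast; rfl
    rw [hyC, ← mul_sub, ← hker t]
    ring
  -- `ζ(1+s)/ζ(1+s−β_j)` on the line is the `L`-series of `ϱ_j` at `1 + s`
  have hzeta : ∀ t : ℝ, zetaRatio c' D j (((1 : ℝ) : ℂ) + (t : ℂ) * I) =
      LSeries ρ ((1 + β) + (((1 : ℝ) : ℂ) + ((t - b : ℝ) : ℂ) * I)) := by
    intro t
    have hs2 : 1 < (1 + (((1 : ℝ) : ℂ) + (t : ℂ) * I)).re := by simp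
    have h7 := stepB_u007_holds c' D j hj (1 + (((1 : ℝ) : ℂ) + (t : ℂ) * I)) hs2
    have harg : (1 + β) + (((1 : ℝ) : ℂ) + ((t - b : ℝ) : ℂ) * I) = 1 + (((1 : ℝ) : ℂ) + (t : ℂ) * I) := by
      rw [hline t]; ring
    rw [harg, hρ, h7, zetaRatio]
  -- the translated integrands and their integrals
  set F : ℝ → ℝ → ℂ := fun cz u =>
    LSeries ρ ((1 + β) + (((1 : ℝ) : ℂ) + (u : ℂ) * I)) * GaussWeight.kernel Λ 1 (P ^ cz / y) u with hF
  have hsum2 : LSeriesSummable ρ ((1 + β) + (1 : ℝ)) := by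
    refine LSeriesSummable_varrhoJ c' D j ?_
    simp [hβ]
    norm_num
  have hX : ∀ cz : ℝ, 0 < P ^ cz / y := fun cz => div_pos (Real.rpow_pos_of_pos hP cz) hy
  have hFint : ∀ cz : ℝ, Integrable (F cz) := fun cz =>
    integrable_LSeries_mul_kernel hΛ one_pos (hX cz) hsum2
  have hFval : ∀ cz : ℝ, (1 / (2 * π) : ℂ) * ∫ u : ℝ, F cz u =
      ∑' n : ℕ, LSeries.term ρ (1 + β) n * (gWeight Λ (P ^ cz / y / n) : ℂ) := fun cz =>
    GaussWeight.integral_LSeries_mul_kernel hΛ one_pos (hX cz) hsum2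
  have hshift : ∀ (cz : ℝ) (t : ℝ),
      zetaRatio c' D j (((1 : ℝ) : ℂ) + (t : ℂ) * I) * A cz t =
        ((P ^ (0.504 : ℝ) / y : ℝ) : ℂ) ^ β * F cz (t - b) := by
    intro cz t
    simp only [hF, hA]
    rw [hzeta t]
    push_cast
    ring
  have hAint : ∀ cz : ℝ, Integrable fun t : ℝ => zetaRatio c' D j (((1 : ℝ) : ℂ) + (t : ℂ) * I) * A cz t := by
    intro cz
    have h := ((hFint cz).comp_sub_right b).const_mul (((P ^ (0.504 : ℝ) / y : ℝ) : ℂ) ^ β)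
    exact h.congr (ae_of_all _ fun t => (hshift cz t).symm)
  have hAval : ∀ cz : ℝ, (1 / (2 * π) : ℂ) * ∫ t : ℝ, zetaRatio c' D j (((1 : ℝ) : ℂ) + (t : ℂ) * I) * A cz t =
      ((P ^ (0.504 : ℝ) / y : ℝ) : ℂ) ^ β *
        ∑' n : ℕ, LSeries.term ρ (1 + β) n * (gWeight Λ (P ^ cz / y / n) : ℂ) := by
    intro cz
    simp_rw [hshift cz]
    rw [MeasureTheory.integral_const_mul,
      MeasureTheory.integral_sub_right_eq_self (F cz) b, ← hFval cz]
    ring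
  -- summability of the two `l`-series against `g`
  have hgsum : ∀ cz : ℝ, Summable fun n : ℕ =>
      LSeries.term ρ (1 + β) n * (gWeight Λ (P ^ cz / y / n) : ℂ) := by
    intro cz
    have hΛ2 : 2 ≤ Λ := by rw [hΛdef]; exact two_le_ell_pow_thirty hD
    have h1 : Summable fun n : ℕ => P ^ cz / y * ‖LSeries.term ρ ((1 + β) + (1 : ℝ)) n‖ :=
      (summable_norm_iff.mpr hsum2).mul_left _
    refine Summable.of_norm_bounded h1 fun n => ?_
    rcases eq_or_ne n 0 with rfl | hn
    · simp [LSeries.term_zero]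
    have hn0 : (0 : ℝ) < n := by exact_mod_cast Nat.pos_of_ne_zero hn
    have hxn : 0 < P ^ cz / y / n := div_pos (hX cz) hn0
    rw [norm_mul, Complex.norm_real, Real.norm_of_nonneg (gWeight_pos hΛ _).le,
      LSeries.norm_term_eq, LSeries.norm_term_eq, if_neg hn, if_neg hn]
    have hre1 : (1 + β).re = 1 := by simp [hβ]
    have hre2 : ((1 + β) + (1 : ℝ)).re = 2 := by simp [hβ]; norm_num
    rw [hre1, hre2, Real.rpow_one]
    calc ‖ρ n‖ / (n : ℝ) * gWeight Λ (P ^ cz / y / n)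
        ≤ ‖ρ n‖ / (n : ℝ) * (P ^ cz / y / n) := by
          gcongr
          exact gWeight_le_self hΛ2 hxn
      _ = P ^ cz / y * (‖ρ n‖ / (n : ℝ) ^ (2 : ℝ)) := by
          rw [Real.rpow_two]; field_simp
  -- assemble the line integral
  rw [vline]
  have hfun : (fun t : ℝ => mellinB14 D z (((1 : ℝ) : ℂ) + (t : ℂ) * I) *
      zetaRatio c' D j (((1 : ℝ) : ℂ) + (t : ℂ) * I) *
        GaussWeight.omega1 (Skeleton.ell D ^ 30) ((((1 : ℝ) : ℂ) + (t : ℂ) * I) - Skeleton.beta6 D) /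
      (((l₁ : ℂ)) ^ (((1 : ℝ) : ℂ) + (t : ℂ) * I) * ((((1 : ℝ) : ℂ) + (t : ℂ) * I) - Skeleton.beta6 D))) =
      fun t : ℝ => zetaRatio c' D j (((1 : ℝ) : ℂ) + (t : ℂ) * I) * A z t -
        zetaRatio c' D j (((1 : ℝ) : ℂ) + (t : ℂ) * I) * A 0.5 t := funext hpt
  rw [hfun, MeasureTheory.integral_sub (hAint z) (hAint 0.5), mul_sub, hAval z, hAval 0.5,
    ← mul_sub, ← Summable.tsum_sub (hgsum z) (hgsum 0.5), ← tsum_mul_left]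
  refine tsum_congr fun n => ?_
  rcases eq_or_ne n 0 with rfl | hn
  · simp [LSeries.term_zero, hρ]
  have hn0 : (0 : ℝ) < n := by exact_mod_cast Nat.pos_of_ne_zero hn
  have hnC : (n : ℂ) ≠ 0 := by exact_mod_cast hn
  have hP5 : 0 < P ^ (0.504 : ℝ) / y := div_pos (Real.rpow_pos_of_pos hP _) hy
  -- the arguments of `g` and of the `β₆`-power
  have harg : ∀ cz : ℝ, P ^ cz / y / n = Skeleton.bigP D ^ cz / ((l₁ * n : ℕ) : ℝ) := by
    intro cz; rw [hPdef, hydef]; push_cast; rw [div_div]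
  have hpow : ((Skeleton.P1 D / (l₁ * n : ℕ) : ℝ) : ℂ) ^ β =
      ((P ^ (0.504 : ℝ) / y : ℝ) : ℂ) ^ β / (n : ℂ) ^ β := by
    have h1 : (Skeleton.P1 D / (l₁ * n : ℕ) : ℝ) = P ^ (0.504 : ℝ) / y / n := by
      rw [Skeleton.P1, hPdef, hydef]; push_cast; rw [div_div]
    rw [h1, GaussWeight.div_cpow_line hP5 hn0, Complex.ofReal_natCast]
  rw [LSeries.term_of_ne_zero hn, hpow, harg, harg, Skeleton.gW, Skeleton.gW,
    Complex.cpow_add _ _ hnC, Complex.cpow_one]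
  have hnβ : (n : ℂ) ^ β ≠ 0 := by
    rw [Ne, Complex.cpow_eq_zero_iff]; exact fun h => hnC h.1
  push_cast
  field_simp
  ring

/-! ## (ii) The `z`-integral and the `l`-sum commute -/

/-- For `D ≥ 3`, `l₁ ≥ 1`, `l ≥ 1`: the function `z ↦ g(P^z/(l₁l))` is monotone, hence interval
integrable on `[0.5, 0.504]`. [cite: Zhang2022LandauSiegel, §4 (4.1)] -/
private theorem intervalIntegrable_gW {D : ℕ} (hD : 3 ≤ D) {y : ℝ} (hy : 0 < y) :
    IntervalIntegrable (fun z : ℝ => Skeleton.gW D (Skeleton.bigP D ^ z / y)) volume 0.5 0.504 := by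
  have hℓ : 0 < Skeleton.ell D := by linarith [Skeleton.one_lt_ell hD]
  have hΛ : 0 < Skeleton.ell D ^ 30 := pow_pos hℓ 30
  have hP0 : 0 < Skeleton.bigP D := Real.exp_pos _
  have hP1 : 1 ≤ Skeleton.bigP D := by
    rw [Skeleton.bigP]; exact Real.one_le_exp (pow_nonneg (Real.log_natCast_nonneg D) 9)
  have hmono : Monotone fun z : ℝ => Skeleton.gW D (Skeleton.bigP D ^ z / y) := fun a c hac =>
    gWeight_mono hΛ (div_pos (Real.rpow_pos_of_pos hP0 a) hy)
      (div_le_div_of_nonneg_right (Real.rpow_le_rpow_of_exponent_le hP1 hac) hy.le)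
  exact hmono.intervalIntegrable

/-- **`seriesB13 = doubleB15`**, exactly, for `D ≥ 3`, `j ∈ {1,2,3}`, `l₁ ≥ 1`: the inner identity
`vline_inner_eq` under the `z`-integral, and Fubini for `∫_{0.5}^{0.504}dz` against `Σ_l` (dominated by
`2P^{0.504}τ(l)/(l₁l²)`, using `0 < g(x) ≤ x`). [cite: Zhang2022LandauSiegel, App. B p.108] -/
theorem seriesB13_eq_doubleB15 (c' : ℝ) {D : ℕ} (hD : 3 ≤ D) {j : ℕ} (hj : j ∈ ({1, 2, 3} : Finset ℕ))
    {l₁ : ℕ} (hl₁ : 1 ≤ l₁) : seriesB13 c' D j l₁ = doubleB15 c' D j l₁ := by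
  have hℓ : 0 < Skeleton.ell D := by linarith [Skeleton.one_lt_ell hD]
  have hΛ : 0 < Skeleton.ell D ^ 30 := pow_pos hℓ 30
  have hΛ2 : 2 ≤ Skeleton.ell D ^ 30 := two_le_ell_pow_thirty hD
  have hP0 : 0 < Skeleton.bigP D := Real.exp_pos _
  have hP1 : 1 ≤ Skeleton.bigP D := by
    rw [Skeleton.bigP]; exact Real.one_le_exp (pow_nonneg (Real.log_natCast_nonneg D) 9)
  have hl₁0 : (0 : ℝ) < l₁ := by exact_mod_cast hl₁
  have hle : (0.5 : ℝ) ≤ 0.504 := by norm_num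
  set P : ℝ := Skeleton.bigP D with hPdef
  set β : ℂ := Skeleton.beta6 D with hβdef
  -- the summands: `h l z = c l * G l z`
  set c : ℕ → ℂ := fun l => varrhoJ c' D j l / (l : ℂ) *
    ((Skeleton.P1 D / (l₁ * l : ℕ) : ℝ) : ℂ) ^ β with hc
  set G : ℕ → ℝ → ℂ := fun l z =>
    ((Skeleton.gW D (P ^ z / (l₁ * l : ℕ)) - Skeleton.gW D (P ^ (0.5 : ℝ) / (l₁ * l : ℕ)) : ℝ) : ℂ)
    with hG
  set h : ℕ → ℝ → ℂ := fun l z => c l * G l z with hh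
  -- Step 1: `doubleB15 = (1/0.504) ∫_z Σ' l, h l z`
  have h1 : doubleB15 c' D j l₁ = ((1 / 0.504 : ℝ) : ℂ) * ∫ z in (0.5 : ℝ)..0.504, ∑' l : ℕ, h l z := by
    rw [doubleB15]
    congr 1
    refine intervalIntegral.integral_congr fun z _ => ?_
    rw [vline_inner_eq c' hD hj hl₁ z]
  -- Step 2: the norm of `c l` and the majorant
  have hc0 : c 0 = 0 := by simp [hc]
  have hh0 : h 0 = fun _ => 0 := by funext z; simp [hh, hc0]
  have hnormc : ∀ l : ℕ, 1 ≤ l → ‖c l‖ = ‖varrhoJ c' D j l‖ / l := by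
    intro l hl
    have hl0 : (0 : ℝ) < l := by exact_mod_cast hl
    have hq : 0 < Skeleton.P1 D / ((l₁ * l : ℕ) : ℝ) := by
      apply div_pos (Real.rpow_pos_of_pos hP0 _)
      push_cast; positivity
    rw [hc, norm_mul, norm_div, Complex.norm_natCast, Complex.norm_cpow_eq_rpow_re_of_pos hq, hβdef]
    have : (Skeleton.beta6 D).re = 0 := by simp [Skeleton.beta6]
    rw [this, Real.rpow_zero, mul_one]
  have hGbound : ∀ l : ℕ, 1 ≤ l → ∀ z : ℝ, z ≤ 0.504 →
      ‖G l z‖ ≤ 2 * P ^ (0.504 : ℝ) / (((l₁ * l : ℕ) : ℝ)) := by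
    intro l hl z hz
    have hy : 0 < ((l₁ * l : ℕ) : ℝ) := by push_cast; positivity
    have hx1 : 0 < P ^ z / ((l₁ * l : ℕ) : ℝ) := div_pos (Real.rpow_pos_of_pos hP0 z) hy
    have hx2 : 0 < P ^ (0.5 : ℝ) / ((l₁ * l : ℕ) : ℝ) := div_pos (Real.rpow_pos_of_pos hP0 _) hy
    have g1 := gWeight_le_self hΛ2 hx1
    have g2 := gWeight_le_self hΛ2 hx2
    have g1p := gWeight_pos hΛ (P ^ z / ((l₁ * l : ℕ) : ℝ))
    have g2p := gWeight_pos hΛ (P ^ (0.5 : ℝ) / ((l₁ * l : ℕ) : ℝ))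
    have hz1 : P ^ z ≤ P ^ (0.504 : ℝ) := Real.rpow_le_rpow_of_exponent_le hP1 hz
    have hz2 : P ^ (0.5 : ℝ) ≤ P ^ (0.504 : ℝ) := Real.rpow_le_rpow_of_exponent_le hP1 (by norm_num)
    simp only [hG, Skeleton.gW] at *
    rw [Complex.norm_real, Real.norm_eq_abs]
    have e1 : P ^ z / ((l₁ * l : ℕ) : ℝ) ≤ P ^ (0.504 : ℝ) / ((l₁ * l : ℕ) : ℝ) :=
      div_le_div_of_nonneg_right hz1 hy.le
    have e2 : P ^ (0.5 : ℝ) / ((l₁ * l : ℕ) : ℝ) ≤ P ^ (0.504 : ℝ) / ((l₁ * l : ℕ) : ℝ) :=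
      div_le_div_of_nonneg_right hz2 hy.le
    rw [abs_le]
    constructor
    · have : 2 * P ^ (0.504 : ℝ) / ((l₁ * l : ℕ) : ℝ) = 2 * (P ^ (0.504 : ℝ) / ((l₁ * l : ℕ) : ℝ)) := by ring
      linarith
    · have : 2 * P ^ (0.504 : ℝ) / ((l₁ * l : ℕ) : ℝ) = 2 * (P ^ (0.504 : ℝ) / ((l₁ * l : ℕ) : ℝ)) := by ring
      linarith
  -- Step 3: integrability of each `h l` on `Ioc 0.5 0.504`
  have hGint : ∀ l : ℕ, 1 ≤ l → IntegrableOn (G l) (Ioc (0.5 : ℝ) 0.504) := by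
    intro l hl
    have hy : 0 < ((l₁ * l : ℕ) : ℝ) := by push_cast; positivity
    have i1 := (intervalIntegrable_gW hD hy).1
    have i2 : IntegrableOn (fun _ : ℝ => Skeleton.gW D (P ^ (0.5 : ℝ) / ((l₁ * l : ℕ) : ℝ)))
        (Ioc (0.5 : ℝ) 0.504) := integrableOn_const (by simp)
    have i3 := (i1.sub i2).ofReal (𝕜 := ℂ)
    refine IntegrableOn.congr_fun i3 (fun z _ => ?_) measurableSet_Ioc
    simp [hG, hPdef]
  have hint : ∀ l : ℕ, Integrable (h l) (volume.restrict (Ioc (0.5 : ℝ) 0.504)) := by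
    intro l
    rcases Nat.eq_zero_or_pos l with rfl | hl
    · rw [hh0]; exact integrable_zero _ _ _
    · exact ((hGint l hl).const_mul (c l))
  -- Step 4: summability of the integrated norms
  obtain ⟨Cτ, hCτ1, hCτ⟩ :=
    Literature.NumberTheory.Sieve.exists_card_divisors_le_mul_rpow' (ε := (1 / 2 : ℝ)) (by norm_num)
  have hsum : Summable fun l : ℕ => ∫ z, ‖h l z‖ ∂(volume.restrict (Ioc (0.5 : ℝ) 0.504)) := by
    have hmaj : Summable fun l : ℕ =>
        (0.004 * (2 * P ^ (0.504 : ℝ) / l₁) * Cτ) * (l : ℝ) ^ (-(3 / 2 : ℝ)) := by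
      refine (Real.summable_nat_rpow.mpr ?_).mul_left _
      norm_num
    refine hmaj.of_nonneg_of_le (fun l => integral_nonneg fun z => norm_nonneg _) fun l => ?_
    rcases Nat.eq_zero_or_pos l with rfl | hl
    · simp [hh0, Real.zero_rpow (by norm_num : -(3 / 2 : ℝ) ≠ 0)]
    have hl0 : (0 : ℝ) < l := by exact_mod_cast hl
    have hy : 0 < ((l₁ * l : ℕ) : ℝ) := by push_cast; positivity
    -- pointwise bound on `Ioc`
    have hptw : ∀ z ∈ Ioc (0.5 : ℝ) 0.504, ‖h l z‖ ≤ ‖varrhoJ c' D j l‖ / l * (2 * P ^ (0.504 : ℝ) / ((l₁ * l : ℕ) : ℝ)) := by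
      intro z hz
      rw [hh]
      dsimp only
      rw [norm_mul, hnormc l hl]
      exact mul_le_mul_of_nonneg_left (hGbound l hl z hz.2) (by positivity)
    have hI : ∫ z, ‖h l z‖ ∂(volume.restrict (Ioc (0.5 : ℝ) 0.504)) ≤
        ∫ z, ‖varrhoJ c' D j l‖ / l * (2 * P ^ (0.504 : ℝ) / ((l₁ * l : ℕ) : ℝ))
          ∂(volume.restrict (Ioc (0.5 : ℝ) 0.504)) := by
      refine setIntegral_mono_on (hint l).norm (integrableOn_const (by simp)) measurableSet_Ioc hptw
    rw [setIntegral_const] at hI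
    have hvol : (volume (Ioc (0.5 : ℝ) 0.504)).toReal = 0.004 := by
      rw [Real.volume_Ioc, ENNReal.toReal_ofReal (by norm_num)]; norm_num
    rw [measureReal_def, hvol, smul_eq_mul] at hI
    refine hI.trans ?_
    have hρ : ‖varrhoJ c' D j l‖ ≤ Cτ * (l : ℝ) ^ (1 / 2 : ℝ) := (norm_varrhoJ_le c' D j l).trans (hCτ l)
    have hK : 0 ≤ 2 * P ^ (0.504 : ℝ) / l₁ := by positivity
    calc (0.004 : ℝ) * (‖varrhoJ c' D j l‖ / l * (2 * P ^ (0.504 : ℝ) / ((l₁ * l : ℕ) : ℝ)))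
        = 0.004 * (2 * P ^ (0.504 : ℝ) / l₁) * ‖varrhoJ c' D j l‖ * ((l : ℝ) * l)⁻¹ := by
          push_cast; field_simp
      _ ≤ 0.004 * (2 * P ^ (0.504 : ℝ) / l₁) * (Cτ * (l : ℝ) ^ (1 / 2 : ℝ)) * ((l : ℝ) * l)⁻¹ := by
          gcongr
      _ = (0.004 * (2 * P ^ (0.504 : ℝ) / l₁) * Cτ) * ((l : ℝ) ^ (1 / 2 : ℝ) * ((l : ℝ) * l)⁻¹) := by
          ring
      _ = (0.004 * (2 * P ^ (0.504 : ℝ) / l₁) * Cτ) * (l : ℝ) ^ (-(3 / 2 : ℝ)) := by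
          congr 1
          rw [show ((l : ℝ) * l)⁻¹ = (l : ℝ) ^ (-(2 : ℝ)) by
            rw [Real.rpow_neg hl0.le, Real.rpow_two, pow_two], ← Real.rpow_add hl0]
          norm_num
  -- Step 5: swap and finish
  have hswap : ∫ z in (0.5 : ℝ)..0.504, ∑' l : ℕ, h l z = ∑' l : ℕ, ∫ z in (0.5 : ℝ)..0.504, h l z := by
    rw [intervalIntegral.integral_of_le hle, ← integral_tsum_of_summable_integral_norm hint hsum]
    refine tsum_congr fun l => ?_
    rw [intervalIntegral.integral_of_le hle]
  rw [h1, hswap, ← tsum_mul_left, seriesB13]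
  refine tsum_congr fun l => ?_
  have hterm : ∫ z in (0.5 : ℝ)..0.504, h l z = c l * ∫ z in (0.5 : ℝ)..0.504, G l z := by
    simp only [hh]
    exact intervalIntegral.integral_const_mul (c l) (G l)
  rw [hterm]
  simp only [hc, hG, hPdef, hβdef]
  ring

/-! ## `Z22:§B.u015` (first line) in the reading of record -/

/-- **`Z22:§B.u015`, first line, HOLDS in the reading of record `α₁ = α log T`**
(`Typed.AppendixB.StepB_u015aR c′`: `‖tailB3 − doubleB15‖ ≤ C·α₁` for all large `D`, `j ∈ {1,2,3}`,
`1 ≤ l₁ ∈ 𝒩(𝔮)`, `l₁ < T`): the double integral EQUALS the smoothed series of `Z22:§B.u013`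
(`seriesB13_eq_doubleB15`), so the claim is `Z22:§B.u013` in the reading of record
(`stepB_u013R_holds`, same constant). Original: "we find that the left side of (B.3) is equal to
`(1/0.504)∫_{0.5}^{0.504}{(1/2πi)∫_{(1)}(P^{β₆(0.504−z)}P^{zs} − P^{0.004β₆}P^{0.5s}) ζ(1+s)/ζ(1+s−β_j)
ω₁(s−β₆)ds/(l₁ˢ(s−β₆))}dz + O`" (App. B p.108, tex L5329–L5331).
[cite: Zhang2022LandauSiegel, App. B p.108] -/
theorem stepB_u015aR_holds (c' : ℝ) : StepB_u015aR c' := by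
  obtain ⟨C, D₀, h⟩ := stepB_u013R_holds c'
  refine ⟨C, max D₀ 3, fun D _ χ hD hq hp => ?_⟩
  intro j hj l₁ hl₁ hn hT
  have hD₀ : D₀ ≤ D := le_trans (le_max_left _ _) hD
  have hD3 : 3 ≤ D := le_trans (le_max_right _ _) hD
  rw [← seriesB13_eq_doubleB15 c' hD3 hj hl₁]
  exact h D χ hD₀ hq hp j hj l₁ hl₁ hn hT

variable (c' : ℝ) in
/-- `StepB_u015aR` — `_holds` alias of `stepB_u015aR_holds` above under the fact's exact name, stated under the
prover's own binders as section variables (appended 2026-08-28, D-0026 bookkeeping: the proof term is the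
existing theorem of this file; no statement, definition or attribute is edited; no new named fact; the
ledger's debt table listed the fact unproved). [cite: Zhang2022LandauSiegel, App. B p.108] -/
theorem _root_.Literature.NumberTheory.LFunctions.Zhang2022.Typed.AppendixB.StepB_u015aR_holds :
    _root_.Literature.NumberTheory.LFunctions.Zhang2022.Typed.AppendixB.StepB_u015aR c' :=
  _root_.Literature.NumberTheory.LFunctions.Zhang2022.AppendixBVarrho.stepB_u015aR_holds (c' := c')

end Literature.NumberTheory.LFunctions.Zhang2022.AppendixBVarrho
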